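import Mathlib
import HarnessLib
import Summits.ValiantsHypothesis.ValiantsHypothesis.Theses.MonotoneRestoration
import Literature.Computability.AlgebraicComplexity.ArithCircuit
import Literature.Computability.AlgebraicComplexity.ArithCircuitProofs
import Literature.Computability.AlgebraicComplexity.MonotoneStructure
import Literature.Computability.AlgebraicComplexity.PermanentIrreducible
import Literature.ModelTheory.FiniteModelTheory.CkEquiv
import Summits.ValiantsHypothesis.ValiantsHypothesis.Theorems.MonotoneRestorationMonotoneRestorationQPCosetCount
import Summits.ValiantsHypothesis.ValiantsHypothesis.Theorems.MonotoneRestorationMonotoneRestorationQPSymmetricLB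
import Summits.ValiantsHypothesis.ValiantsHypothesis.Theorems.MonotoneRestorationMonotoneRestorationQPSupportSymmetrisation
import Summits.ValiantsHypothesis.ValiantsHypothesis.Theorems.MonotoneRestorationMonotoneRestorationQPSparseRegime
import Summits.ValiantsHypothesis.ValiantsHypothesis.Theorems.MonotoneRestorationMonotoneRestorationQPBeta
import Literature.Computability.AlgebraicComplexity.SymmetricArithCircuit
import Literature.Computability.AlgebraicComplexity.DawarWilsenach2025Proofs
import Literature.GroupTheory.PermutationGroups.SmallIndexSubgroups
import Summits.ValiantsHypothesis.ValiantsHypothesis.Theorems.MonotoneRestorationQP.Negative.LoadBearing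
import Summits.ValiantsHypothesis.ValiantsHypothesis.Theorems.MonotoneRestorationMonotoneRestorationQPPermSupportCount

/-! # TTRL-lite variant V22110 of `MonotoneRestorationQP` / `stub_symmetricMonotone_choose_le_card` (stmt-ValiantsHypothesis-15886)

Machine-generated helper (refuted variant); move `small_case`, op `llm`: DECIDABLE FALSE companion of the 3-cycle transitivity lemma (gamma_exists_threeCycle needs |X|+3 <= n): on Fin 4 with |X|+2 <= 4, X = {0,1}, a = 2, b = 3 the only permutation fixing X and sending 2 to.
See docs/architecture/ttrl-lite.md. -/

namespace Summit.ValiantsHypothesis.ValiantsHypothesis.Theorems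

open Summit.ValiantsHypothesis.ValiantsHypothesis.Theses.MonotoneRestoration
open Literature.Computability.AlgebraicComplexity

/-- TTRL-lite variant V22110 (small_case `llm`) of `stub_symmetricMonotone_choose_le_card` (stmt-ValiantsHypothesis-15886); machine-found, kernel-checked. -/
theorem stub_symmetricMonotone_choose_le_card_var22110_false :
    ¬ (∀ (X : Finset (Fin 4)) (a b : Fin 4), X.card + 2 ≤ 4 → a ∉ X → b ∉ X → ∃ ρ : Equiv.Perm (Fin 4), (∀ x ∈ X, ρ x = x) ∧ Equiv.Perm.sign ρ = 1 ∧ ρ a = b) := by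
  decide

end Summit.ValiantsHypothesis.ValiantsHypothesis.Theorems
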